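import Mathlib.LinearAlgebra.Dimension.StrongRankCondition
import Mathlib.LinearAlgebra.FiniteDimensional.Lemmas
import Mathlib.Data.Real.Basic
import Mathlib.Algebra.Order.BigOperators.Group.Finset
import Mathlib.Tactic.FieldSimp
import Mathlib.Tactic.Linarith
import Mathlib.Tactic.Positivity
import HarnessLib

/-!
# Generation of a polyhedral kernel cone by vectors of small support (conic Carathéodory)

For a finite index type `J` and a linear map `L : (J → ℝ) →ₗ[ℝ] (Fin p → ℝ)`, the polyhedral cone
`K = {c : J → ℝ | c ≥ 0, L c = 0}` is generated, under sums and positive scalings, by its elements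
with at most `p + 1` nonzero coordinates (`cone_induction`, stated as an induction principle: a
property of vectors of `K` which holds on those of support `≤ p + 1` and is stable under `+` and
under multiplication by positive reals holds on all of `K`). This is the conic form of
Carathéodory's theorem (Mathlib has the convex-hull form, `Mathlib.Analysis.Convex.Caratheodory`:
`convexHull_eq_union`, but not this one): the extreme rays of `K` have at most `rank L + 1 ≤ p + 1`
nonzero coordinates. Proof: a vector of `K` with `≥ p + 2` nonzero coordinates admits a nonzero
kernel direction `d` supported on `p + 1` of them (`p + 1` vectors in `ℝᵖ` are dependent); moving
along `±d` until a coordinate vanishes (`exists_sub_smul_nonneg`) writes the vector as a positive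
combination of one or two vectors of `K` of smaller support, or of one of smaller support and `d`
itself when `d ≥ 0`.

Used for the convexity step (Lemma 5 / Corollary 6) of Pebody's proof of the
Kleinberg–Sawin–Speyer conjecture (`Literature/Combinatorics/Additive/TricoloredSumFreeLowerBound*.lean`),
where `J = Fin 3 × Fin (M+1)` indexes mixtures of uniform distributions and `p = 3`.

## References

* [folklore] Carathéodory's theorem for convex cones / basic solutions of linear programs; e.g.
  A. Schrijver, *Theory of Linear and Integer Programming*, §7.7 (Carathéodory's theorem, conic
  version), or any text on polyhedral cones.
-/

noncomputable section

open Finset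

open scoped BigOperators

namespace Literature.Analysis.Convex

section Cone

variable {J : Type*} [Fintype J]

/-- One reduction step: subtracting the largest admissible multiple of a direction `d` with a
positive entry from a nonnegative vector `c` kills one more coordinate. [folklore] -/
theorem exists_sub_smul_nonneg (c d : J → ℝ) (hc : ∀ j, 0 ≤ c j) (hdc : ∀ j, d j ≠ 0 → c j ≠ 0)
    (hpos : ∃ j, 0 < d j) :
    ∃ t : ℝ, 0 < t ∧ (∀ j, 0 ≤ c j - t * d j) ∧ ∃ j₀, d j₀ ≠ 0 ∧ c j₀ - t * d j₀ = 0 := by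
  classical
  set P : Finset J := Finset.univ.filter fun j => 0 < d j with hP
  have hPne : P.Nonempty := by
    obtain ⟨j, hj⟩ := hpos
    exact ⟨j, Finset.mem_filter.2 ⟨Finset.mem_univ _, hj⟩⟩
  obtain ⟨j₀, hj₀P, hj₀⟩ := Finset.exists_mem_eq_inf' hPne fun j => c j / d j
  set t := P.inf' hPne fun j => c j / d j with ht
  have hd₀ : 0 < d j₀ := (Finset.mem_filter.1 hj₀P).2
  have hc₀ : 0 < c j₀ := lt_of_le_of_ne (hc j₀) (Ne.symm (hdc j₀ hd₀.ne'))
  refine ⟨t, ?_, fun j => ?_, j₀, hd₀.ne', ?_⟩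
  · rw [hj₀]; exact div_pos hc₀ hd₀
  · rcases le_or_gt (d j) 0 with hdj | hdj
    · have : 0 ≤ t := by rw [hj₀]; exact (div_pos hc₀ hd₀).le
      nlinarith [hc j]
    · have htle : t ≤ c j / d j :=
        Finset.inf'_le (fun j => c j / d j) (Finset.mem_filter.2 ⟨Finset.mem_univ j, hdj⟩)
      rw [le_div_iff₀ hdj] at htle
      linarith
  · rw [hj₀, div_mul_cancel₀ _ hd₀.ne', sub_self]

/-- **Conic Carathéodory as an induction principle**: a property of nonnegative vectors in the
kernel of a linear map to `ℝᵖ` that holds on kernel vectors with at most `p + 1` nonzero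
coordinates and is stable under sums and positive scalings holds on the whole cone
`{c ≥ 0, L c = 0}`. (Proof: a vector with `≥ p + 2` nonzero coordinates admits a kernel direction
supported on `p + 1` of them, by dimension count; moving along it in one or both directions until a
coordinate vanishes writes the vector as a positive combination of cone vectors of smaller
support.) [folklore] -/
theorem cone_induction {p : ℕ} (L : (J → ℝ) →ₗ[ℝ] (Fin p → ℝ)) (Q : (J → ℝ) → Prop)
    (hbase : ∀ c : J → ℝ, (∀ j, 0 ≤ c j) → L c = 0 →
      (Finset.univ.filter fun j => c j ≠ 0).card ≤ p + 1 → Q c)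
    (hadd : ∀ c c' : J → ℝ, Q c → Q c' → Q (c + c'))
    (hsmul : ∀ (t : ℝ) (c : J → ℝ), 0 < t → Q c → Q (t • c)) :
    ∀ c : J → ℝ, (∀ j, 0 ≤ c j) → L c = 0 → Q c := by
  classical
  suffices H : ∀ n, ∀ c : J → ℝ, (Finset.univ.filter fun j => c j ≠ 0).card = n →
      (∀ j, 0 ≤ c j) → L c = 0 → Q c from fun c hc hL => H _ c rfl hc hL
  intro n
  induction n using Nat.strong_induction_on with
  | _ n ih =>
  intro c hcard hc hL
  by_cases hn : n ≤ p + 1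
  · exact hbase c hc hL (hcard ▸ hn)
  -- a subset `S` of the support with `p + 1` elements
  set supp : Finset J := Finset.univ.filter fun j => c j ≠ 0 with hsupp
  obtain ⟨S, hSsub, hScard⟩ : ∃ S ⊆ supp, S.card = p + 1 :=
    Finset.exists_subset_card_eq (by rw [hcard]; omega)
  -- extension by zero from `S`
  let E : (S → ℝ) →ₗ[ℝ] (J → ℝ) :=
    { toFun := fun g j => if h : j ∈ S then g ⟨j, h⟩ else 0
      map_add' := fun g g' => by
        ext j; simp only [Pi.add_apply]; split_ifs <;> simp
      map_smul' := fun t g => by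
        ext j; simp only [Pi.smul_apply, RingHom.id_apply]; split_ifs <;> simp }
  have hE : ∀ g : S → ℝ, ∀ j, E g j = if h : j ∈ S then g ⟨j, h⟩ else 0 := fun g j => rfl
  -- a nonzero kernel direction supported on `S`
  have hnotinj : ¬ Function.Injective (L.comp E) := by
    intro hinj
    have h1 := LinearMap.finrank_le_finrank_of_injective hinj
    rw [Module.finrank_fintype_fun_eq_card, Module.finrank_fintype_fun_eq_card,
      Fintype.card_coe, hScard, Fintype.card_fin] at h1
    omega
  obtain ⟨g, hg, hg0⟩ : ∃ g : S → ℝ, L.comp E g = 0 ∧ g ≠ 0 := by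
    by_contra hcon
    push Not at hcon
    exact hnotinj ((injective_iff_map_eq_zero _).2 hcon)
  -- basic facts about `d = E g` (and `-d`)
  have hLd : L (E g) = 0 := hg
  have hdS : ∀ j, E g j ≠ 0 → j ∈ S := by
    intro j hj; rw [hE] at hj
    by_contra h; exact hj (dif_neg h)
  have hdne : ∃ j, E g j ≠ 0 := by
    by_contra hcon
    push Not at hcon
    apply hg0; ext ⟨j, hj⟩
    have := hcon j
    rw [hE, dif_pos hj] at this
    exact this
  -- the generic step, for a direction `d` with a positive entry
  have step : ∀ d : J → ℝ, L d = 0 → (∀ j, d j ≠ 0 → j ∈ S) → (∃ j, 0 < d j) →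
      ∃ t : ℝ, 0 < t ∧ (∀ j, 0 ≤ (c - t • d) j) ∧ L (c - t • d) = 0 ∧ Q (c - t • d) := by
    intro d hLd' hdS' hpos
    have hdc : ∀ j, d j ≠ 0 → c j ≠ 0 := fun j hj =>
      (Finset.mem_filter.1 (hSsub (hdS' j hj))).2
    obtain ⟨t, ht, hnn, j₀, hj₀, hzero⟩ := exists_sub_smul_nonneg c d hc hdc hpos
    have hnn' : ∀ j, 0 ≤ (c - t • d) j := fun j => by simpa using hnn j
    have hL' : L (c - t • d) = 0 := by rw [map_sub, map_smul, hL, hLd', smul_zero, sub_zero]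
    refine ⟨t, ht, hnn', hL', ih _ ?_ _ rfl hnn' hL'⟩
    rw [← hcard]
    refine Finset.card_lt_card ⟨fun j hj => ?_, ?_⟩
    · rw [Finset.mem_filter] at hj ⊢
      refine ⟨Finset.mem_univ _, fun hcj => hj.2 ?_⟩
      have hdj : d j = 0 := by by_contra h; exact hdc j h hcj
      simp [hcj, hdj]
    · rw [Finset.not_subset]
      refine ⟨j₀, Finset.mem_filter.2 ⟨Finset.mem_univ _, hdc j₀ hj₀⟩, fun h => ?_⟩
      rw [Finset.mem_filter] at h
      exact h.2 (by simpa using hzero)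
  -- choose the sign of `d`
  obtain ⟨d, hLd', hdS', hpos⟩ : ∃ d : J → ℝ, L d = 0 ∧ (∀ j, d j ≠ 0 → j ∈ S) ∧ ∃ j, 0 < d j := by
    by_cases h : ∃ j, 0 < E g j
    · exact ⟨E g, hLd, hdS, h⟩
    · push Not at h
      obtain ⟨j, hj⟩ := hdne
      refine ⟨-E g, by rw [map_neg, hLd, neg_zero], fun j' hj' => hdS j' (by simpa using hj'),
        j, ?_⟩
      simp only [Pi.neg_apply, Left.neg_pos_iff]
      exact lt_of_le_of_ne (h j) hj
  obtain ⟨t, ht, hnn, hLt, hQt⟩ := step d hLd' hdS' hpos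
  by_cases hneg : ∃ j, d j < 0
  · -- move in both directions
    obtain ⟨j, hj⟩ := hneg
    obtain ⟨s, hs, hnn', hLs, hQs⟩ := step (-d) (by rw [map_neg, hLd', neg_zero])
      (fun j' hj' => hdS' j' (by simpa using hj')) ⟨j, by simpa using hj⟩
    have hts : 0 < t + s := add_pos ht hs
    have key : c = (s / (t + s)) • (c - t • d) + (t / (t + s)) • (c - s • (-d)) := by
      ext j
      simp only [Pi.add_apply, Pi.smul_apply, Pi.sub_apply, Pi.neg_apply, smul_eq_mul]
      field_simp
      ring
    rw [key]
    exact hadd _ _ (hsmul _ _ (div_pos hs hts) hQt) (hsmul _ _ (div_pos ht hts) hQs)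
  · -- `d ≥ 0` lies in the cone and has small support
    push Not at hneg
    have hQd : Q d := by
      refine hbase d hneg hLd' ((Finset.card_le_card fun j hj => ?_).trans hScard.le)
      exact hdS' j (Finset.mem_filter.1 hj).2
    have key : c = (c - t • d) + t • d := by simp
    rw [key]
    exact hadd _ _ hQt (hsmul t d ht hQd)

end Cone

end Literature.Analysis.Convex
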